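import Literature.NumberTheory.ComplexMultiplication.SexticPrimitiveCMTypesGaloisEquivalent
import Literature.NumberTheory.ComplexMultiplication.SexticCMFieldQuadraticOrPairFlip
import Literature.NumberTheory.ComplexMultiplication.PairKernelPrimeDegree
import Literature.NumberTheory.ComplexMultiplication.PairKernelQuadraticSubfield
import Literature.NumberTheory.ComplexMultiplication.ImprimitivityBound
import Literature.NumberTheory.ComplexMultiplication.CMFieldNormalClosure
import HarnessLib

/-!
# The sextic table of Dodson (1984, §5.1.2 Theorem, §5.1.3 Prop. 1 for `n = 3`) as biconditionals: for a sextic CM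
# field `K` with Galois closure `L`, `[L : ℚ] ∈ {6, 12, 24, 48}`; ONE Galois class of CM types `⟺ [L : ℚ] ∈ {24, 48}
# ⟺ v = 3 ⟺` no imaginary quadratic subfield `⟺` pair flips; TWO classes (partition `2³ = 2 + 6`) `⟺ [L : ℚ] ∈
# {6, 12} ⟺ v = 1 ⟺ K ⊇` an imaginary quadratic field; `[K₀ᶜ : ℚ] ∈ {3, 6}`

Layer `Literature/NumberTheory/ComplexMultiplication`, namespace `Literature.NumberTheory.ComplexMultiplication` (lane
`lit-hodgefound`, Track 2 foundations, Layer A3; seat `lit-hodgefound-p11`, generation 25, row g25-#2).  Sequel of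
`SexticPrimitiveCMTypesGaloisEquivalent` (g25-#1: a sextic CM field has `1` or `2` Galois classes, `2` iff it contains
an imaginary quadratic field; DIS Cor. 13), on the tree's Dodson files `ImprimitivityBound` (`[L : ℚ] ∣ 2ⁿ·n!`, so
`∣ 48`), `PairKernelPrimeDegree` (`[L : K₀ᶜ] ∈ {2, 8}` for `n = 3`), `PairKernelQuadraticSubfield` (imaginary quadratic
subfield ⟹ `[L : K₀ᶜ] = 2`), `ReflexDegreeMaximal` / `CMTypeGaloisClassesSingle` (`v = n` ⟹ one class),
`SexticCMTypeGaloisClassesPairFlip` (g24-#11: `[L : ℚ] ∈ {24, 48}` ⟹ `v = 3`, one class) and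
`SexticCMFieldQuadraticOrPairFlip` (a sextic CM field has pair flips OR an imaginary quadratic subfield).  THEOREMS ONLY;
no definition, no named fact (D-0026).

THE PRINT.  B. Dodson, *The structure of Galois groups of CM-fields*, Trans. AMS 283 (1984) (held text
`paper:doi-10-2307-1999987`, p0020):

> §5.1.2 «Now recall the transitive `G₀` for `n = 3, 5` and `7`. For `n = 3`, there are only `G₀ = ℤ₃` and `S₃` …
> THEOREM. For `n = 3, 5` and `7` there are a total of `33` `ρ`-structures. Of these, `28` are the split structures
> `ℤ₂ × G₀` and `(ℤ₂)ⁿ ⋊ G₀` for the above `14` `G₀` …» (for `n = 3`: `ℤ₂ × ℤ₃`, `ℤ₂ × 𝔖₃`, `(ℤ₂)³ ⋊ ℤ₃`,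
> `(ℤ₂)³ ⋊ 𝔖₃`, of order `6, 12, 24, 48`).
> §5.1.3 «PROPOSITION 1. When `n = 3`, `v = 1`, the partition `2³ = 2 + 6` holds for both `G = ℤ₂ × G₀`, and `2³ = 8`
> holds for both `G = (ℤ₂)³ ⋊ G₀`. … That the case `v = n` gives a single orbit has been previously distinguished by
> Shimura.»  (The partition is that of the `2ⁿ` CM types into `G`-orbits, i.e. Galois classes, §1.3 Remark: «`[K′ : ℚ]`
> is also the order of the orbit of `Φ`»; §3.1.1: `v = 1` when `K = k·K₀` with `k` imaginary quadratic.)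

B. Dina, S. Ionica, J. Sijsling (2022) §1.2 Props. 10–12 give the same four groups as `C₆`, `D₆`, `C₂³ ⋊ C₃`,
`C₂³ ⋊ S₃` with `2, 2, 1, 1` Galois classes.

WHAT IS PROVED (`K` a CM field, `L` a normal closure of `K` over `ℚ` which is a CM field — e.g. any normal closure,
tree `isCMField_of_isNormalClosure` —, `K₀ᶜ := normalClosure ℚ K⁺ L`, `2ᵛ = [L : K₀ᶜ]`).
* §1 (any degree) `finrank_dvd_finrank_of_isNormalClosure` (`[K : ℚ] ∣ [L : ℚ]`), **`finrank_traceField_dvd_finrank_normalClosure`**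
  (`[ℚ(tr_Φ) : ℚ] ∣ [L : ℚ]`: the reflex field lies in `L`), `two_pow_dvd_finrank_normalClosure_of_card_eq_one` (one
  Galois class ⟹ `2ⁿ ∣ [L : ℚ]`).
* §2 (sextic) **`finrank_normalClosure_mem_of_finrank_eq_six`** (`[L : ℚ] ∈ {6, 12, 24, 48}`);
  **`card_cmTypeGaloisClasses_eq_one_iff_finrank_normalClosure`** (one class `⟺ [L : ℚ] ∈ {24, 48}`),
  **`card_cmTypeGaloisClasses_eq_two_iff_finrank_normalClosure`** (two classes `⟺ [L : ℚ] ∈ {6, 12}`),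
  `exists_quadratic_iff_finrank_normalClosure` / `no_quadratic_iff_finrank_normalClosure` (imaginary quadratic subfield
  `⟺ {6, 12}`); the exponent `v`: **`finrank_normalClosure_maximalRealSubfield_eq_eight_iff_card_eq_one`**,
  **`…_eq_two_iff_card_eq_two`**, `…_eq_two_iff_exists_quadratic` (the sextic converse of the tree's Dodson §3.1.1),
  `…_eq_eight_iff_finrank`, `…_eq_two_iff_finrank`; **DODSON §5.1.3 PROP. 1 (`n = 3`)**:
  **`dodson_partition_of_finrank_normalClosure_eq_two`** (`v = 1` ⟹ two classes, of `2` and `6` members) and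
  `dodson_partition_of_finrank_normalClosure_eq_two_pow` (`v = n` ⟹ a single orbit of `2ⁿ`, any degree) /
  `…_eq_eight`; **`finrank_normalClosure_maximalRealSubfield_base_mem`** (`[K₀ᶜ : ℚ] ∈ {3, 6}`: `G₀ = ℤ₃, 𝔖₃`) and
  the four rows **`dodson_sextic_table`** (`([L:ℚ], 2ᵛ, [K₀ᶜ:ℚ], #classes) ∈ {(6,2,3,2), (12,2,6,2), (24,8,3,1), (48,8,6,1)}`).
* §3 pair flips (an automorphism of `ℂ` exchanging `s, s̄` and fixing the other embeddings; any degree unless said):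
  `forall_pairFlip_of_exists_pairFlip` (a flip at one pair gives flips at all pairs), `exists_galFlip_of_pairFlips`
  (transfer to `Gal(L/ℚ)`), **`finrank_normalClosure_maximalRealSubfield_eq_two_pow_of_pairFlips`** (flips ⟹ `v = n`),
  **`card_cmTypeGaloisClasses_eq_one_of_pairFlips`** (flips ⟹ ONE Galois class; no `L` in the statement — the normal
  closure inside `ℂ` is used), **`not_pairFlip_of_quadratic`** (a CM field of degree `≥ 4` with an imaginary quadratic
  subfield has NO pair flip), and for sextic `K`: **`forall_pairFlip_iff_card_cmTypeGaloisClasses_eq_one`**,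
  `forall_pairFlip_iff_no_quadratic`, `forall_pairFlip_iff_finrank_normalClosure` (`⟺ [L : ℚ] ∈ {24, 48}`),
  **`pairFlips_xor_exists_quadratic`** — the tree's dichotomy `pairFlip_or_exists_imaginary_quadratic` is EXCLUSIVE.

## References

* [Dodson1984] B. Dodson, *The structure of Galois groups of CM-fields*, Trans. AMS 283 (1984), §1.1 Imprimitivity
  Theorem, §1.3 Reflex Degree Theorem and Remark, §3.1.1, §5.1.1 (p. 20), §5.1.2 Theorem, §5.1.3 Proposition 1.
* [DinaIonicaSijsling2022] B. Dina, S. Ionica, J. Sijsling, Math. Comp. 91 (2022), §1.2 Def. 8, Props. 10–12, Cor. 13.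
* [Shimura1998] G. Shimura, *Abelian Varieties with Complex Multiplication and Modular Functions* (1998), §8.2
  Prop. 26, §8.3 Prop. 28.

## Provenance

Lane `lit-hodgefound` (HOME `run/shared/lean/pub/lit-hodgefound/`), prover seat `lit-hodgefound-p11` (gen 25),
self-proposed row g25-#2 (INBOX claim 2026-08-27, l.40528).
-/

set_option autoImplicit false

noncomputable section

open scoped Classical NumberField Pointwise
open NumberField Module IntermediateField NumberField.ComplexEmbedding

namespace Literature.NumberTheory.ComplexMultiplication

open Literature.AlgebraicGeometry.Motives (CMType)
open Literature.AlgebraicGeometry.Motives.HodgeStructure (cmTypeSmul cmTypeSmul_val)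
open Literature.AlgebraicGeometry.Pohlmann1968 (isCMTypeWith_conj isPretransitive_ringEquiv_complex
  conj_smul_eq_conjugate)

variable {K : Type} [Field K] [NumberField K] [IsCMField K]

/-! ## §1 Degrees in a normal closure (any CM field) -/

section Degrees

variable {L : Type} [Field L] [NumberField L] [IsCMField L] [IsNormalClosure ℚ K L]

omit [IsCMField K] [IsCMField L] [IsNormalClosure ℚ K L] in
/-- `[φ(K) : ℚ] = [K : ℚ]`. [folklore] -/
private theorem finrank_fieldRange_eq'' (φ : K →ₐ[ℚ] L) : finrank ℚ φ.fieldRange = finrank ℚ K := by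
  rw [← IntermediateField.finrank_eq_finrank_subalgebra, AlgHom.fieldRange_toSubalgebra]
  exact (AlgEquiv.ofInjectiveField φ).toLinearEquiv.finrank_eq.symm

omit [IsCMField K] [IsCMField L] in
/-- A normal closure of `K` receives `K`. [folklore] -/
private theorem nonempty_algHom_of_isNormalClosure : Nonempty (K →ₐ[ℚ] L) :=
  Fintype.card_pos_iff.1 (by rw [card_algHom_eq_finrank K]; exact Module.finrank_pos)

omit [IsCMField K] [IsCMField L] in
/-- **`[K : ℚ] ∣ [Kᶜ : ℚ]`** (tower law along an embedding `K → L`). [cite: Dodson1984, §1.1] -/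
theorem finrank_dvd_finrank_of_isNormalClosure : finrank ℚ K ∣ finrank ℚ L := by
  obtain ⟨j⟩ := nonempty_algHom_of_isNormalClosure (K := K) (L := L)
  rw [← finrank_fieldRange_eq'' j]
  exact ⟨_, (Module.finrank_mul_finrank ℚ j.fieldRange L).symm⟩

omit [IsCMField K] [IsCMField L] in
/-- **The reflex degree divides `[Kᶜ : ℚ]`**: `[ℚ(tr_Φ) : ℚ] ∣ [L : ℚ]` — the reflex field `K′(Φ)` is a subfield of the
Galois closure (`traceField Φ = ι(K*_L)`, tree `finrank_traceField_eq_finrank_reflexField`).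
[cite: Dodson1984, §1.3 Reflex Degree Theorem] [cite: Shimura1998, §8.3 Prop. 28] -/
theorem finrank_traceField_dvd_finrank_normalClosure (Φ : CMType K) : finrank ℚ (traceField Φ) ∣ finrank ℚ L := by
  obtain ⟨j⟩ := nonempty_algHom_of_isNormalClosure (K := K) (L := L)
  obtain ⟨ι⟩ : Nonempty (L →+* ℂ) := inferInstance
  haveI : IsGalois ℚ L := isGalois_of_isNormalClosure (L := L) K
  rw [finrank_traceField_eq_finrank_reflexField j ι Φ]
  exact ⟨_, (Module.finrank_mul_finrank ℚ (reflexField ℚ L (algValuedIn ι Φ.1)) L).symm⟩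

omit [IsCMField L] in
/-- One Galois class ⟹ `2ⁿ ∣ [Kᶜ : ℚ]` (the reflex degree is then `2ⁿ`, g24-#9). [cite: Dodson1984, §1.3 Remark and §5.1.3]
[cite: Shimura1998, §8.3 Prop. 28] -/
theorem two_pow_dvd_finrank_normalClosure_of_card_eq_one (h1 : Nat.card (Quotient (cmTypeGaloisSetoid K)) = 1) :
    2 ^ (finrank ℚ K / 2) ∣ finrank ℚ L := by
  obtain ⟨Φ⟩ : Nonempty (CMType K) := CMTypeCount.nonempty_cmType_iff_isTotallyComplex.2 inferInstance
  rw [← card_cmTypeGaloisClasses_eq_one_iff_forall.1 h1 Φ]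
  exact finrank_traceField_dvd_finrank_normalClosure (L := L) Φ

end Degrees

/-! ## §2 Sextic CM fields: `[L : ℚ] ∈ {6, 12, 24, 48}`, the number of Galois classes, `v`, and `[K₀ᶜ : ℚ]` -/

section Sextic

variable {L : Type} [Field L] [NumberField L] [IsCMField L] [IsNormalClosure ℚ K L]

/-- **`[Kᶜ : ℚ] ∈ {6, 12, 24, 48}` for a sextic CM field** (Dodson's four sextic `ρ`-structures `ℤ₂ × ℤ₃`, `ℤ₂ × 𝔖₃`,
`(ℤ₂)³ ⋊ ℤ₃`, `(ℤ₂)³ ⋊ 𝔖₃`): `[L : ℚ] ∣ 48` (the tree's imprimitivity bound) and `6 ∣ [L : ℚ]`.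
[cite: Dodson1984, §1.1 Imprimitivity Theorem and §5.1.2 Theorem] -/
theorem finrank_normalClosure_mem_of_finrank_eq_six (h6 : finrank ℚ K = 6) :
    finrank ℚ L = 6 ∨ finrank ℚ L = 12 ∨ finrank ℚ L = 24 ∨ finrank ℚ L = 48 := by
  have h48 := finrank_dvd_48_of_sextic_cm (L := L) K h6
  have h6d : 6 ∣ finrank ℚ L := h6 ▸ finrank_dvd_finrank_of_isNormalClosure (K := K) (L := L)
  obtain ⟨m, hm⟩ := h6d
  rw [hm] at h48 ⊢
  have h' : 6 * m ∣ 6 * 2 ^ 3 := by norm_num; exact h48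
  obtain ⟨k, hk, rfl⟩ := (Nat.dvd_prime_pow Nat.prime_two).1 (Nat.dvd_of_mul_dvd_mul_left (by norm_num) h')
  interval_cases k <;> simp

/-- **ONE Galois class `⟺ [Kᶜ : ℚ] ∈ {24, 48}`** (`⟸` is g24-#11; `⟹`: the reflex degree `8` divides `[L : ℚ]`, which
excludes `6` and `12`). [cite: Dodson1984, §5.1.3 Proposition 1] [cite: DinaIonicaSijsling2022, §1.2 Prop. 12] -/
theorem card_cmTypeGaloisClasses_eq_one_iff_finrank_normalClosure (h6 : finrank ℚ K = 6) :
    Nat.card (Quotient (cmTypeGaloisSetoid K)) = 1 ↔ finrank ℚ L = 24 ∨ finrank ℚ L = 48 := by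
  constructor
  · intro h1
    have h8 := two_pow_dvd_finrank_normalClosure_of_card_eq_one (L := L) h1
    rw [h6] at h8
    norm_num at h8
    rcases finrank_normalClosure_mem_of_finrank_eq_six (L := L) h6 with h | h | h | h <;> rw [h] at h8 ⊢ <;> omega
  · exact card_cmTypeGaloisClasses_eq_one_of_sextic (L := L) h6

/-- **TWO Galois classes `⟺ [Kᶜ : ℚ] ∈ {6, 12}`** (a sextic CM field has `1` or `2` classes, g25-#1).
[cite: Dodson1984, §5.1.3 Proposition 1] [cite: DinaIonicaSijsling2022, §1.2 Props. 10–11] -/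
theorem card_cmTypeGaloisClasses_eq_two_iff_finrank_normalClosure (h6 : finrank ℚ K = 6) :
    Nat.card (Quotient (cmTypeGaloisSetoid K)) = 2 ↔ finrank ℚ L = 6 ∨ finrank ℚ L = 12 := by
  have h1 := card_cmTypeGaloisClasses_eq_one_iff_finrank_normalClosure (L := L) h6
  constructor
  · intro h2
    rcases finrank_normalClosure_mem_of_finrank_eq_six (L := L) h6 with h' | h' | h' | h'
    · exact Or.inl h'
    · exact Or.inr h'
    · exfalso
      have := h1.2 (Or.inl h')
      omega
    · exfalso
      have := h1.2 (Or.inr h')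
      omega
  · intro hL
    rcases card_cmTypeGaloisClasses_eq_one_or_eq_two_of_finrank_eq_six h6 with h | h
    · exfalso
      rcases h1.1 h with h' | h' <;> rcases hL with hL | hL <;> omega
    · exact h

/-- **`K` contains an imaginary quadratic field `⟺ [Kᶜ : ℚ] ∈ {6, 12}`** (`K = k·K₀`, `G = ℤ₂ × G₀`).
[cite: Dodson1984, §3.1.1 and §5.1.2 Theorem] [cite: DinaIonicaSijsling2022, §1.2 Props. 10–11] -/
theorem exists_quadratic_iff_finrank_normalClosure (h6 : finrank ℚ K = 6) :
    (∃ k : IntermediateField ℚ K, finrank ℚ k = 2 ∧ Nonempty (CMType k)) ↔ finrank ℚ L = 6 ∨ finrank ℚ L = 12 := by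
  rw [← card_cmTypeGaloisClasses_eq_two_iff_exists_quadratic h6,
    card_cmTypeGaloisClasses_eq_two_iff_finrank_normalClosure (L := L) h6]

/-- **No imaginary quadratic subfield `⟺ [Kᶜ : ℚ] ∈ {24, 48}`** (`G = (ℤ₂)³ ⋊ G₀`). [cite: Dodson1984, §5.1.2 Theorem]
[cite: DinaIonicaSijsling2022, §1.2 Prop. 12] -/
theorem no_quadratic_iff_finrank_normalClosure (h6 : finrank ℚ K = 6) :
    (∀ k : IntermediateField ℚ K, finrank ℚ k = 2 → IsEmpty (CMType k)) ↔ finrank ℚ L = 24 ∨ finrank ℚ L = 48 := by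
  rw [← card_cmTypeGaloisClasses_eq_one_iff_no_quadratic h6,
    card_cmTypeGaloisClasses_eq_one_iff_finrank_normalClosure (L := L) h6]

/-- **`v = 3` (`[L : K₀ᶜ] = 8`) `⟺` ONE Galois class** (`⟹`: Dodson's «the case `v = n` gives a single orbit», g24-#9;
`⟸`: one class ⟹ `[L : ℚ] ∈ {24, 48}` ⟹ `v = 3`, g24-#11). [cite: Dodson1984, §5.1.3 Proposition 1] -/
theorem finrank_normalClosure_maximalRealSubfield_eq_eight_iff_card_eq_one (h6 : finrank ℚ K = 6) :
    finrank (normalClosure ℚ (maximalRealSubfield K) L) L = 8 ↔ Nat.card (Quotient (cmTypeGaloisSetoid K)) = 1 := by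
  obtain ⟨j⟩ := nonempty_algHom_of_isNormalClosure (K := K) (L := L)
  constructor
  · intro hv
    exact card_cmTypeGaloisClasses_eq_one_of_finrank_normalClosure_eq j (by rw [hv, h6]; norm_num)
  · intro h1
    exact finrank_normalClosure_maximalRealSubfield_eq_eight h6
      ((card_cmTypeGaloisClasses_eq_one_iff_finrank_normalClosure (L := L) h6).1 h1)

/-- **`v = 1` (`[L : K₀ᶜ] = 2`) `⟺` TWO Galois classes** (`[L : K₀ᶜ] ∈ {2, 8}` for `n = 3`, tree `PairKernelPrimeDegree`).
[cite: Dodson1984, §5.1.1 (p. 20) and §5.1.3 Proposition 1] -/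
theorem finrank_normalClosure_maximalRealSubfield_eq_two_iff_card_eq_two (h6 : finrank ℚ K = 6) :
    finrank (normalClosure ℚ (maximalRealSubfield K) L) L = 2 ↔ Nat.card (Quotient (cmTypeGaloisSetoid K)) = 2 := by
  obtain ⟨j⟩ := nonempty_algHom_of_isNormalClosure (K := K) (L := L)
  have hv := finrank_normalClosure_eq_of_finrank_eq_six j h6
  have h12 := card_cmTypeGaloisClasses_eq_one_or_eq_two_of_finrank_eq_six h6
  have h8 := finrank_normalClosure_maximalRealSubfield_eq_eight_iff_card_eq_one (L := L) h6
  constructor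
  · intro h2
    rcases h12 with h1 | h1
    · have := h8.2 h1
      omega
    · exact h1
  · intro h2
    rcases hv with h | h
    · exact h
    · have := h8.1 h
      omega

/-- **`v = 1 ⟺ K` contains an imaginary quadratic field** (sextic; `⟸` in every degree is the tree's Dodson §3.1.1
`finrank_normalClosure_maximalRealSubfield_eq_two_of_ringHom`). [cite: Dodson1984, §3.1.1 and §5.1.2]
[cite: DinaIonicaSijsling2022, §1.2 Props. 10–11] -/
theorem finrank_normalClosure_maximalRealSubfield_eq_two_iff_exists_quadratic (h6 : finrank ℚ K = 6) :
    finrank (normalClosure ℚ (maximalRealSubfield K) L) L = 2 ↔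
      ∃ k : IntermediateField ℚ K, finrank ℚ k = 2 ∧ Nonempty (CMType k) := by
  rw [finrank_normalClosure_maximalRealSubfield_eq_two_iff_card_eq_two (L := L) h6,
    card_cmTypeGaloisClasses_eq_two_iff_exists_quadratic h6]

/-- `v = 3 ⟺` no imaginary quadratic subfield (sextic). [cite: Dodson1984, §5.1.2 Theorem] [cite: DinaIonicaSijsling2022, §1.2 Prop. 12] -/
theorem finrank_normalClosure_maximalRealSubfield_eq_eight_iff_no_quadratic (h6 : finrank ℚ K = 6) :
    finrank (normalClosure ℚ (maximalRealSubfield K) L) L = 8 ↔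
      ∀ k : IntermediateField ℚ K, finrank ℚ k = 2 → IsEmpty (CMType k) := by
  rw [finrank_normalClosure_maximalRealSubfield_eq_eight_iff_card_eq_one (L := L) h6,
    card_cmTypeGaloisClasses_eq_one_iff_no_quadratic h6]

/-- `v = 3 ⟺ [Kᶜ : ℚ] ∈ {24, 48}`. [cite: Dodson1984, §5.1.2 Theorem] -/
theorem finrank_normalClosure_maximalRealSubfield_eq_eight_iff_finrank (h6 : finrank ℚ K = 6) :
    finrank (normalClosure ℚ (maximalRealSubfield K) L) L = 8 ↔ finrank ℚ L = 24 ∨ finrank ℚ L = 48 := by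
  rw [finrank_normalClosure_maximalRealSubfield_eq_eight_iff_card_eq_one (L := L) h6,
    card_cmTypeGaloisClasses_eq_one_iff_finrank_normalClosure (L := L) h6]

/-- `v = 1 ⟺ [Kᶜ : ℚ] ∈ {6, 12}`. [cite: Dodson1984, §5.1.2 Theorem] -/
theorem finrank_normalClosure_maximalRealSubfield_eq_two_iff_finrank (h6 : finrank ℚ K = 6) :
    finrank (normalClosure ℚ (maximalRealSubfield K) L) L = 2 ↔ finrank ℚ L = 6 ∨ finrank ℚ L = 12 := by
  rw [finrank_normalClosure_maximalRealSubfield_eq_two_iff_card_eq_two (L := L) h6,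
    card_cmTypeGaloisClasses_eq_two_iff_finrank_normalClosure (L := L) h6]

/-- **DODSON §5.1.3 PROP. 1, `n = 3`, `v = 1`: «the partition `2³ = 2 + 6` holds for both `G = ℤ₂ × G₀`»** — two Galois
classes; every class has `2` or `6` members; a class of `2` (the types `{ψ^K, ψ̄^K}` induced from the imaginary quadratic
subfield) and a class of `6` (the primitive types) both occur. [cite: Dodson1984, §5.1.3 Proposition 1]
[cite: DinaIonicaSijsling2022, §1.2 Props. 10–11] -/
theorem dodson_partition_of_finrank_normalClosure_eq_two (h6 : finrank ℚ K = 6)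
    (hv : finrank (normalClosure ℚ (maximalRealSubfield K) L) L = 2) :
    Nat.card (Quotient (cmTypeGaloisSetoid K)) = 2 ∧
      (∀ Φ : CMType K, Nat.card {Ψ : CMType K // ∃ τ : ℂ ≃+* ℂ, Ψ = cmTypeSmul τ Φ} = 2 ∨
        Nat.card {Ψ : CMType K // ∃ τ : ℂ ≃+* ℂ, Ψ = cmTypeSmul τ Φ} = 6) ∧
      (∃ Φ : CMType K, Nat.card {Ψ : CMType K // ∃ τ : ℂ ≃+* ℂ, Ψ = cmTypeSmul τ Φ} = 2) ∧
      ∃ Φ : CMType K, Nat.card {Ψ : CMType K // ∃ τ : ℂ ≃+* ℂ, Ψ = cmTypeSmul τ Φ} = 6 := by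
  have h2 := (finrank_normalClosure_maximalRealSubfield_eq_two_iff_card_eq_two (L := L) h6).1 hv
  obtain ⟨k₀, hk₀, ⟨Ψ₀⟩⟩ := (card_cmTypeGaloisClasses_eq_two_iff_exists_quadratic h6).1 h2
  haveI := CMTypeLattice.isTotallyComplex_of_cmType Ψ₀
  refine ⟨h2, fun Φ => ?_, ⟨inducedCMType (algebraMap k₀ K) Ψ₀, ?_⟩, ?_⟩
  · rw [natCard_galoisClass_eq_finrank_traceField]
    exact finrank_traceField_eq_two_or_six_of_quadratic k₀ h6 hk₀ Φ
  · rw [natCard_galoisClass_eq_finrank_traceField]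
    exact finrank_traceField_inducedCMType_quadratic k₀ hk₀ Ψ₀
  · have hpos : 0 < Nat.card {Φ : CMType K //
        ¬ ∃ (k : IntermediateField ℚ K) (Ψ : CMType k), k ≠ ⊤ ∧ inducedCMType (algebraMap k K) Ψ = Φ} := by
      rw [natCard_not_induced_eq_six_of_finrank_eq_six_of_quadratic h6 k₀ hk₀]; norm_num
    obtain ⟨⟨Φ₁, hΦ₁⟩⟩ := (Nat.card_pos_iff.1 hpos).1
    obtain ⟨φ₀⟩ := (inferInstance : Nonempty (K →+* ℂ))
    refine ⟨Φ₁, ?_⟩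
    rw [natCard_galoisClass_eq_finrank_traceField]
    exact finrank_traceField_eq_six_of_isPrimitive_of_quadratic k₀ h6 hk₀
      ((SiegelCMPoint.not_exists_inducedCMType_iff_isPrimitive Φ₁ φ₀).1 hΦ₁)

/-- **DODSON §5.1.3 PROP. 1, `v = n`: «the case `v = n` gives a single orbit»** (any degree): one Galois class, of all
`2ⁿ` types (g24-#9 packaged). [cite: Dodson1984, §5.1.3 Proposition 1] -/
theorem dodson_partition_of_finrank_normalClosure_eq_two_pow
    (hv : finrank (normalClosure ℚ (maximalRealSubfield K) L) L = 2 ^ (finrank ℚ K / 2)) :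
    Nat.card (Quotient (cmTypeGaloisSetoid K)) = 1 ∧
      ∀ Φ : CMType K, Nat.card {Ψ : CMType K // ∃ τ : ℂ ≃+* ℂ, Ψ = cmTypeSmul τ Φ} = 2 ^ (finrank ℚ K / 2) := by
  obtain ⟨j⟩ := nonempty_algHom_of_isNormalClosure (K := K) (L := L)
  refine ⟨card_cmTypeGaloisClasses_eq_one_of_finrank_normalClosure_eq j hv, fun Φ => ?_⟩
  rw [natCard_galoisClass_eq_finrank_traceField]
  exact finrank_traceField_eq_two_pow_of_finrank_normalClosure_eq j hv Φ

/-- **… `n = 3`, `v = 3`: «`2³ = 8` holds for both `G = (ℤ₂)³ ⋊ G₀`»** — one class of `8`. [cite: Dodson1984, §5.1.3 Proposition 1]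
[cite: DinaIonicaSijsling2022, §1.2 Prop. 12] -/
theorem dodson_partition_of_finrank_normalClosure_eq_eight (h6 : finrank ℚ K = 6)
    (hv : finrank (normalClosure ℚ (maximalRealSubfield K) L) L = 8) :
    Nat.card (Quotient (cmTypeGaloisSetoid K)) = 1 ∧
      ∀ Φ : CMType K, Nat.card {Ψ : CMType K // ∃ τ : ℂ ≃+* ℂ, Ψ = cmTypeSmul τ Φ} = 8 := by
  have h := dodson_partition_of_finrank_normalClosure_eq_two_pow (K := K) (L := L) (by rw [hv, h6]; norm_num)
  rw [h6] at h
  exact h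

/-- **`[K₀ᶜ : ℚ] ∈ {3, 6}`** («For `n = 3`, there are only `G₀ = ℤ₃` and `S₃`»): `[L : ℚ] = [L : K₀ᶜ]·[K₀ᶜ : ℚ]` with
`([L : ℚ], [L : K₀ᶜ]) ∈ {(6, 2), (12, 2), (24, 8), (48, 8)}`. [cite: Dodson1984, §5.1.2] -/
theorem finrank_normalClosure_maximalRealSubfield_base_mem (h6 : finrank ℚ K = 6) :
    finrank ℚ (normalClosure ℚ (maximalRealSubfield K) L) = 3 ∨ finrank ℚ (normalClosure ℚ (maximalRealSubfield K) L) = 6 := by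
  obtain ⟨j⟩ := nonempty_algHom_of_isNormalClosure (K := K) (L := L)
  have htower := Module.finrank_mul_finrank ℚ (normalClosure ℚ (maximalRealSubfield K) L) L
  rcases finrank_normalClosure_eq_of_finrank_eq_six j h6 with hv | hv
  · have hL := (finrank_normalClosure_maximalRealSubfield_eq_two_iff_finrank (L := L) h6).1 hv
    rw [hv] at htower
    rcases hL with h | h <;> rw [h] at htower <;> omega
  · have hL := (finrank_normalClosure_maximalRealSubfield_eq_eight_iff_finrank (L := L) h6).1 hv
    rw [hv] at htower
    rcases hL with h | h <;> rw [h] at htower <;> omega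

/-- **THE SEXTIC TABLE** `([Kᶜ : ℚ], [Kᶜ : K₀ᶜ], [K₀ᶜ : ℚ], #Galois classes) ∈ {(6, 2, 3, 2), (12, 2, 6, 2), (24, 8, 3, 1),
(48, 8, 6, 1)}` — Dodson's `ℤ₂ × ℤ₃`, `ℤ₂ × 𝔖₃`, `(ℤ₂)³ ⋊ ℤ₃`, `(ℤ₂)³ ⋊ 𝔖₃` = DIS's `C₆`, `D₆`, `C₂³ ⋊ C₃`, `C₂³ ⋊ S₃`
with `2, 2, 1, 1` Galois classes. [cite: Dodson1984, §5.1.2 Theorem and §5.1.3 Proposition 1]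
[cite: DinaIonicaSijsling2022, §1.2 Props. 10–12] -/
theorem dodson_sextic_table (h6 : finrank ℚ K = 6) :
    (finrank ℚ L = 6 ∧ finrank (normalClosure ℚ (maximalRealSubfield K) L) L = 2 ∧
        finrank ℚ (normalClosure ℚ (maximalRealSubfield K) L) = 3 ∧ Nat.card (Quotient (cmTypeGaloisSetoid K)) = 2) ∨
    (finrank ℚ L = 12 ∧ finrank (normalClosure ℚ (maximalRealSubfield K) L) L = 2 ∧
        finrank ℚ (normalClosure ℚ (maximalRealSubfield K) L) = 6 ∧ Nat.card (Quotient (cmTypeGaloisSetoid K)) = 2) ∨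
    (finrank ℚ L = 24 ∧ finrank (normalClosure ℚ (maximalRealSubfield K) L) L = 8 ∧
        finrank ℚ (normalClosure ℚ (maximalRealSubfield K) L) = 3 ∧ Nat.card (Quotient (cmTypeGaloisSetoid K)) = 1) ∨
    (finrank ℚ L = 48 ∧ finrank (normalClosure ℚ (maximalRealSubfield K) L) L = 8 ∧
        finrank ℚ (normalClosure ℚ (maximalRealSubfield K) L) = 6 ∧ Nat.card (Quotient (cmTypeGaloisSetoid K)) = 1) := by
  have htower := Module.finrank_mul_finrank ℚ (normalClosure ℚ (maximalRealSubfield K) L) L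
  have hv2 := finrank_normalClosure_maximalRealSubfield_eq_two_iff_finrank (K := K) (L := L) h6
  have hv8 := finrank_normalClosure_maximalRealSubfield_eq_eight_iff_finrank (K := K) (L := L) h6
  have hc1 := card_cmTypeGaloisClasses_eq_one_iff_finrank_normalClosure (K := K) (L := L) h6
  have hc2 := card_cmTypeGaloisClasses_eq_two_iff_finrank_normalClosure (K := K) (L := L) h6
  rcases finrank_normalClosure_mem_of_finrank_eq_six (L := L) h6 with h | h | h | h
  · have hv := hv2.2 (Or.inl h)
    refine Or.inl ⟨h, hv, ?_, hc2.2 (Or.inl h)⟩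
    rw [hv, h] at htower
    omega
  · have hv := hv2.2 (Or.inr h)
    refine Or.inr (Or.inl ⟨h, hv, ?_, hc2.2 (Or.inr h)⟩)
    rw [hv, h] at htower
    omega
  · have hv := hv8.2 (Or.inl h)
    refine Or.inr (Or.inr (Or.inl ⟨h, hv, ?_, hc1.2 (Or.inl h)⟩))
    rw [hv, h] at htower
    omega
  · have hv := hv8.2 (Or.inr h)
    refine Or.inr (Or.inr (Or.inr ⟨h, hv, ?_, hc1.2 (Or.inr h)⟩))
    rw [hv, h] at htower
    omega

end Sextic

/-! ## §3 Pair flips: an automorphism of `ℂ` exchanging `s, s̄` and fixing the other embeddings of `K` -/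

section PairFlips

/-- **A flip at one pair gives flips at every pair** (conjugate by an automorphism of `ℂ` carrying `s₀` to `s`: `Aut(ℂ)` is
transitive on `Hom(K, ℂ)` and commutes with complex conjugation on embeddings of a CM field). [cite: Dodson1984, §1.1 Imprimitivity Theorem (2)] -/
theorem forall_pairFlip_of_exists_pairFlip
    (h : ∃ (s₀ : K →+* ℂ) (σ : ℂ ≃+* ℂ), σ • s₀ = (starRingAut : ℂ ≃+* ℂ) • s₀ ∧
      ∀ t : K →+* ℂ, t ≠ s₀ → t ≠ (starRingAut : ℂ ≃+* ℂ) • s₀ → σ • t = t)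
    (s : K →+* ℂ) :
    ∃ σ : ℂ ≃+* ℂ, σ • s = (starRingAut : ℂ ≃+* ℂ) • s ∧
      ∀ t : K →+* ℂ, t ≠ s → t ≠ (starRingAut : ℂ ≃+* ℂ) • s → σ • t = t := by
  haveI := isPretransitive_ringEquiv_complex (K := K)
  have hcm := isCMTypeWith_conj (CMTypeCount.stdCMType (K := K))
  obtain ⟨s₀, σ, hσ, hfix⟩ := h
  obtain ⟨γ, hγ⟩ := MulAction.exists_smul_eq (ℂ ≃+* ℂ) s₀ s
  refine ⟨γ * σ * γ⁻¹, ?_, fun t ht ht' => ?_⟩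
  · rw [mul_smul, mul_smul, ← hγ, inv_smul_smul, hσ, hcm.comm]
  · rw [mul_smul, mul_smul]
    have h1 : γ⁻¹ • t ≠ s₀ := fun h' => ht (by rw [← hγ, ← h', smul_inv_smul])
    have h2 : γ⁻¹ • t ≠ (starRingAut : ℂ ≃+* ℂ) • s₀ := fun h' =>
      ht' (by rw [← hγ, ← hcm.comm, ← h', smul_inv_smul])
    rw [hfix _ h1 h2, smul_inv_smul]

/-- Flips at every pair `⟺` a flip at some pair. [cite: Dodson1984, §1.1 Imprimitivity Theorem (2)] -/
theorem forall_pairFlip_iff_exists_pairFlip :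
    (∀ s : K →+* ℂ, ∃ σ : ℂ ≃+* ℂ, σ • s = (starRingAut : ℂ ≃+* ℂ) • s ∧
        ∀ t : K →+* ℂ, t ≠ s → t ≠ (starRingAut : ℂ ≃+* ℂ) • s → σ • t = t) ↔
      ∃ (s₀ : K →+* ℂ) (σ : ℂ ≃+* ℂ), σ • s₀ = (starRingAut : ℂ ≃+* ℂ) • s₀ ∧
        ∀ t : K →+* ℂ, t ≠ s₀ → t ≠ (starRingAut : ℂ ≃+* ℂ) • s₀ → σ • t = t := by
  obtain ⟨s₀⟩ := (inferInstance : Nonempty (K →+* ℂ))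
  exact ⟨fun h => ⟨s₀, h s₀⟩, fun h s => forall_pairFlip_of_exists_pairFlip h s⟩

section Transfer

variable {L : Type} [Field L] [NumberField L] [IsCMField L]

omit [IsCMField K] in
/-- **Transfer to `Gal(L/ℚ)`**: through `Hom_ℚ(K, L) ≃ Hom(K, ℂ)` (`L` normal) complex pair flips give, for every
`χ : K → L`, an element of `Gal(L/ℚ)` acting as `ρ` on `{χ, ρχ}` and trivially on the other embeddings (the dictionary
`exists_algEquiv_forall_algHomEquivRingHomOfNormal_smul`). [cite: Dodson1984, §1.1] [cite: Shimura1998, §8.1 Prop. 25] -/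
theorem exists_galFlip_of_pairFlips [Normal ℚ L] (j : K →ₐ[ℚ] L) (ι : L →+* ℂ)
    (h : ∀ s : K →+* ℂ, ∃ σ : ℂ ≃+* ℂ, σ • s = (starRingAut : ℂ ≃+* ℂ) • s ∧
      ∀ t : K →+* ℂ, t ≠ s → t ≠ (starRingAut : ℂ ≃+* ℂ) • s → σ • t = t)
    (χ : K →ₐ[ℚ] L) :
    ∃ g : L ≃ₐ[ℚ] L, g • χ = (conjGal : L ≃ₐ[ℚ] L) • χ ∧
      ∀ y : K →ₐ[ℚ] L, y ≠ χ → y ≠ (conjGal : L ≃ₐ[ℚ] L) • χ → g • y = y := by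
  obtain ⟨σ, hσ, hfix⟩ := h (algHomEquivRingHomOfNormal j ι χ)
  obtain ⟨g, hg⟩ := exists_algEquiv_forall_algHomEquivRingHomOfNormal_smul j ι σ
  refine ⟨g, (algHomEquivRingHomOfNormal j ι).injective ?_, fun y hy hy' =>
    (algHomEquivRingHomOfNormal j ι).injective ?_⟩
  · rw [hg, hσ, conj_smul_eq_conjugate, algHomEquivRingHomOfNormal_conjGal_smul]
  · rw [hg]
    refine hfix _ (fun h' => hy ((algHomEquivRingHomOfNormal j ι).injective h')) fun h' => hy'
      ((algHomEquivRingHomOfNormal j ι).injective ?_)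
    rw [algHomEquivRingHomOfNormal_conjGal_smul, ← conj_smul_eq_conjugate]
    exact h'

variable [IsNormalClosure ℚ K L]

/-- **Pair flips ⟹ `v = n`: `[L : K₀ᶜ] = 2ⁿ`** — every sign change is a Galois automorphism (the pair flips, in
`Gal(L/K₀ᶜ)`, generate `(ℤ₂)ⁿ`; tree `IsCMTypeWith.card_pairKernel_eq_two_pow_of_flips`).  Any degree.
[cite: Dodson1984, §5.1.2 (the split structures `(ℤ₂)ⁿ ⋊ G₀`) and §5.1.3] -/
theorem finrank_normalClosure_maximalRealSubfield_eq_two_pow_of_pairFlips (j : K →ₐ[ℚ] L)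
    (h : ∀ s : K →+* ℂ, ∃ σ : ℂ ≃+* ℂ, σ • s = (starRingAut : ℂ ≃+* ℂ) • s ∧
      ∀ t : K →+* ℂ, t ≠ s → t ≠ (starRingAut : ℂ ≃+* ℂ) • s → σ • t = t) :
    finrank (normalClosure ℚ (maximalRealSubfield K) L) L = 2 ^ (finrank ℚ K / 2) := by
  classical
  haveI : IsGalois ℚ L := isGalois_of_isNormalClosure (L := L) K
  haveI : Normal ℚ L := IsNormalClosure.normal (F := ℚ) (K := K) (L := L)
  obtain ⟨ι⟩ : Nonempty (L →+* ℂ) := inferInstance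
  obtain ⟨Φ₀⟩ : Nonempty (CMType K) := CMTypeCount.nonempty_cmType_iff_isTotallyComplex.2 inferInstance
  have hW := isCMTypeWith_conjGal_algValuedIn ι Φ₀ (L := L)
  have hV := hW.card_pairKernel_eq_two_pow_of_flips
    (V := (normalClosure ℚ (maximalRealSubfield K) L).fixingSubgroup)
    (mem_fixingSubgroup_normalClosure_maximalRealSubfield_iff j) (exists_galFlip_of_pairFlips j ι h)
  rw [IsGalois.card_fixingSubgroup_eq_finrank, Nat.card_eq_fintype_card, card_algHom_eq_finrank K] at hV
  exact hV

end Transfer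

/-- **Pair flips ⟹ ONE Galois class of CM types** (any degree): `v = n` in the normal closure of `K` inside `ℂ`, and
Dodson's «the case `v = n` gives a single orbit» (g24-#9). [cite: Dodson1984, §5.1.3 Proposition 1]
[cite: DinaIonicaSijsling2022, §1.2 Prop. 12] -/
theorem card_cmTypeGaloisClasses_eq_one_of_pairFlips
    (h : ∀ s : K →+* ℂ, ∃ σ : ℂ ≃+* ℂ, σ • s = (starRingAut : ℂ ≃+* ℂ) • s ∧
      ∀ t : K →+* ℂ, t ≠ s → t ≠ (starRingAut : ℂ ≃+* ℂ) • s → σ • t = t) :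
    Nat.card (Quotient (cmTypeGaloisSetoid K)) = 1 := by
  let C : IntermediateField ℚ ℂ := normalClosure ℚ K ℂ
  haveI : IsNormalClosure ℚ K C := Algebra.IsAlgebraic.isNormalClosure_normalClosure fun x => IsAlgClosed.splits _
  haveI : NumberField C := NumberField.mk
  haveI : IsCMField C := isCMField_of_isNormalClosure (K := K) (L := C)
  obtain ⟨j⟩ := nonempty_algHom_of_isNormalClosure (K := K) (L := C)
  exact card_cmTypeGaloisClasses_eq_one_of_finrank_normalClosure_eq j
    (finrank_normalClosure_maximalRealSubfield_eq_two_pow_of_pairFlips j h)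

/-- Pair flips ⟹ any two CM types are Galois equivalent. [cite: Dodson1984, §5.1.3 Proposition 1] -/
theorem galoisRel_of_pairFlips
    (h : ∀ s : K →+* ℂ, ∃ σ : ℂ ≃+* ℂ, σ • s = (starRingAut : ℂ ≃+* ℂ) • s ∧
      ∀ t : K →+* ℂ, t ≠ s → t ≠ (starRingAut : ℂ ≃+* ℂ) • s → σ • t = t) (Φ Ψ : CMType K) :
    (cmTypeGaloisSetoid K).r Φ Ψ :=
  card_cmTypeGaloisClasses_eq_one_iff.1 (card_cmTypeGaloisClasses_eq_one_of_pairFlips h) Φ Ψ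

/-- Pair flips ⟹ every CM type has the maximal reflex degree `2ⁿ`. [cite: Dodson1984, §1.3 and §5.1.3 Proposition 1] -/
theorem finrank_traceField_eq_two_pow_of_pairFlips
    (h : ∀ s : K →+* ℂ, ∃ σ : ℂ ≃+* ℂ, σ • s = (starRingAut : ℂ ≃+* ℂ) • s ∧
      ∀ t : K →+* ℂ, t ≠ s → t ≠ (starRingAut : ℂ ≃+* ℂ) • s → σ • t = t) (Φ : CMType K) :
    finrank ℚ (traceField Φ) = 2 ^ (finrank ℚ K / 2) :=
  card_cmTypeGaloisClasses_eq_one_iff_forall.1 (card_cmTypeGaloisClasses_eq_one_of_pairFlips h) Φ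

/-- **A CM field of degree `≥ 4` with an imaginary quadratic subfield has NO pair flip** (the class `{ψ^K, ψ̄^K}` makes
`≥ 2` Galois classes, g24-#10; a flip would force one). [cite: Dodson1984, §3.1.1 and §5.1.2] [cite: DinaIonicaSijsling2022, §1.2 Props. 10–11] -/
theorem not_pairFlip_of_quadratic (h4 : 4 ≤ finrank ℚ K) (k₀ : IntermediateField ℚ K) (hk₀ : finrank ℚ k₀ = 2)
    [IsTotallyComplex k₀] (s : K →+* ℂ) :
    ¬ ∃ σ : ℂ ≃+* ℂ, σ • s = (starRingAut : ℂ ≃+* ℂ) • s ∧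
      ∀ t : K →+* ℂ, t ≠ s → t ≠ (starRingAut : ℂ ≃+* ℂ) • s → σ • t = t := by
  intro hs
  obtain ⟨Ψ₀⟩ : Nonempty (CMType k₀) := CMTypeCount.nonempty_cmType_iff_isTotallyComplex.2 inferInstance
  have h1 := card_cmTypeGaloisClasses_eq_one_of_pairFlips (forall_pairFlip_of_exists_pairFlip ⟨s, hs⟩)
  have h2 := two_le_card_cmTypeGaloisClasses_of_quadratic k₀ hk₀ h4 Ψ₀
  omega

/-- **Sextic: pair flips `⟺` ONE Galois class.** (`⟸`: one class ⟹ no imaginary quadratic subfield (g25-#1) ⟹ flips,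
tree `pairFlip_or_exists_imaginary_quadratic`.) [cite: Dodson1984, §5.1.2 Theorem and §5.1.3 Proposition 1] -/
theorem forall_pairFlip_iff_card_cmTypeGaloisClasses_eq_one (h6 : finrank ℚ K = 6) :
    (∀ s : K →+* ℂ, ∃ σ : ℂ ≃+* ℂ, σ • s = (starRingAut : ℂ ≃+* ℂ) • s ∧
        ∀ t : K →+* ℂ, t ≠ s → t ≠ (starRingAut : ℂ ≃+* ℂ) • s → σ • t = t) ↔
      Nat.card (Quotient (cmTypeGaloisSetoid K)) = 1 := by
  refine ⟨card_cmTypeGaloisClasses_eq_one_of_pairFlips, fun h1 => ?_⟩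
  rcases pairFlip_or_exists_imaginary_quadratic h6 with h | ⟨F, hF, hFc⟩
  · exact h
  · exfalso
    haveI := hFc
    have h2 := card_cmTypeGaloisClasses_eq_two_of_quadratic F h6 hF
    omega

/-- Sextic: pair flips `⟺` no imaginary quadratic subfield. [cite: Dodson1984, §5.1.2 Theorem] [cite: DinaIonicaSijsling2022, §1.2 Prop. 12] -/
theorem forall_pairFlip_iff_no_quadratic (h6 : finrank ℚ K = 6) :
    (∀ s : K →+* ℂ, ∃ σ : ℂ ≃+* ℂ, σ • s = (starRingAut : ℂ ≃+* ℂ) • s ∧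
        ∀ t : K →+* ℂ, t ≠ s → t ≠ (starRingAut : ℂ ≃+* ℂ) • s → σ • t = t) ↔
      ∀ k : IntermediateField ℚ K, finrank ℚ k = 2 → IsEmpty (CMType k) := by
  rw [forall_pairFlip_iff_card_cmTypeGaloisClasses_eq_one h6, card_cmTypeGaloisClasses_eq_one_iff_no_quadratic h6]

/-- **Sextic: the dichotomy «pair flips OR an imaginary quadratic subfield» of the tree is EXCLUSIVE.**
[cite: Dodson1984, §5.1.2 Theorem] -/
theorem pairFlips_xor_exists_quadratic (h6 : finrank ℚ K = 6) :
    Xor (∀ s : K →+* ℂ, ∃ σ : ℂ ≃+* ℂ, σ • s = (starRingAut : ℂ ≃+* ℂ) • s ∧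
        ∀ t : K →+* ℂ, t ≠ s → t ≠ (starRingAut : ℂ ≃+* ℂ) • s → σ • t = t)
      (∃ F : IntermediateField ℚ K, finrank ℚ F = 2 ∧ IsTotallyComplex F) := by
  have hexcl : (∃ F : IntermediateField ℚ K, finrank ℚ F = 2 ∧ IsTotallyComplex F) →
      ¬ ∀ s : K →+* ℂ, ∃ σ : ℂ ≃+* ℂ, σ • s = (starRingAut : ℂ ≃+* ℂ) • s ∧
        ∀ t : K →+* ℂ, t ≠ s → t ≠ (starRingAut : ℂ ≃+* ℂ) • s → σ • t = t := by
    rintro ⟨F, hF, hFc⟩ hall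
    obtain ⟨s⟩ := (inferInstance : Nonempty (K →+* ℂ))
    haveI := hFc
    exact not_pairFlip_of_quadratic (by omega) F hF s (hall s)
  rcases pairFlip_or_exists_imaginary_quadratic h6 with h | h
  · exact Or.inl ⟨h, fun h' => hexcl h' h⟩
  · exact Or.inr ⟨h, hexcl h⟩

section WithClosure

variable {L : Type} [Field L] [NumberField L] [IsCMField L] [IsNormalClosure ℚ K L]

/-- Sextic: pair flips `⟺ [Kᶜ : ℚ] ∈ {24, 48}` (the Galois closures `(ℤ₂)³ ⋊ ℤ₃`, `(ℤ₂)³ ⋊ 𝔖₃`).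
[cite: Dodson1984, §5.1.2 Theorem] -/
theorem forall_pairFlip_iff_finrank_normalClosure (h6 : finrank ℚ K = 6) :
    (∀ s : K →+* ℂ, ∃ σ : ℂ ≃+* ℂ, σ • s = (starRingAut : ℂ ≃+* ℂ) • s ∧
        ∀ t : K →+* ℂ, t ≠ s → t ≠ (starRingAut : ℂ ≃+* ℂ) • s → σ • t = t) ↔
      finrank ℚ L = 24 ∨ finrank ℚ L = 48 := by
  rw [forall_pairFlip_iff_card_cmTypeGaloisClasses_eq_one h6,
    card_cmTypeGaloisClasses_eq_one_iff_finrank_normalClosure (L := L) h6]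

/-- Sextic: pair flips `⟺ v = 3`. [cite: Dodson1984, §5.1.2 Theorem and §5.1.3 Proposition 1] -/
theorem forall_pairFlip_iff_finrank_normalClosure_maximalRealSubfield_eq_eight (h6 : finrank ℚ K = 6) :
    (∀ s : K →+* ℂ, ∃ σ : ℂ ≃+* ℂ, σ • s = (starRingAut : ℂ ≃+* ℂ) • s ∧
        ∀ t : K →+* ℂ, t ≠ s → t ≠ (starRingAut : ℂ ≃+* ℂ) • s → σ • t = t) ↔
      finrank (normalClosure ℚ (maximalRealSubfield K) L) L = 8 := by
  rw [forall_pairFlip_iff_card_cmTypeGaloisClasses_eq_one h6,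
    finrank_normalClosure_maximalRealSubfield_eq_eight_iff_card_eq_one (L := L) h6]

/-- An imaginary quadratic subfield of a sextic CM field: `[Kᶜ : ℚ] ∈ {6, 12}`, `v = 1`, two Galois classes, no pair
flip (the row `ℤ₂ × G₀` of the table, from the subfield). [cite: Dodson1984, §3.1.1 and §5.1.2–5.1.3] -/
theorem sextic_row_of_quadratic (h6 : finrank ℚ K = 6) (k₀ : IntermediateField ℚ K) (hk₀ : finrank ℚ k₀ = 2)
    [IsTotallyComplex k₀] :
    (finrank ℚ L = 6 ∨ finrank ℚ L = 12) ∧ finrank (normalClosure ℚ (maximalRealSubfield K) L) L = 2 ∧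
      Nat.card (Quotient (cmTypeGaloisSetoid K)) = 2 ∧
      ∀ s : K →+* ℂ, ¬ ∃ σ : ℂ ≃+* ℂ, σ • s = (starRingAut : ℂ ≃+* ℂ) • s ∧
        ∀ t : K →+* ℂ, t ≠ s → t ≠ (starRingAut : ℂ ≃+* ℂ) • s → σ • t = t := by
  have hex : ∃ k : IntermediateField ℚ K, finrank ℚ k = 2 ∧ Nonempty (CMType k) :=
    ⟨k₀, hk₀, CMTypeCount.nonempty_cmType_iff_isTotallyComplex.2 inferInstance⟩
  exact ⟨(exists_quadratic_iff_finrank_normalClosure (L := L) h6).1 hex,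
    (finrank_normalClosure_maximalRealSubfield_eq_two_iff_exists_quadratic (L := L) h6).2 hex,
    (card_cmTypeGaloisClasses_eq_two_iff_exists_quadratic h6).2 hex,
    fun s => not_pairFlip_of_quadratic (by omega) k₀ hk₀ s⟩

end WithClosure

end PairFlips

end Literature.NumberTheory.ComplexMultiplication
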